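/-
Copyright (c) 2026 the pub-hodgecm-mathlib formalisation cell (harness21).  Prover seat hodgecm-mathlib-K2E3-p24 (g0), Track B «K2-LIT» ∕ h413
(`stmt-HodgeConjecture-24833`), line `K2_E3_EllipticInputs`, road (11-3-split-nsc), leaf (nsc-S-C′) `sig_K2E3GL3TwoBlockCuspidalSupportCharLocInt`,
brick (vD-σ-MU): INTEGRATING OUT THE UNIPOTENT RADICAL — the character of an inflated representation of `P = M ⋉ U`.  2026-09-04.
-/
import Literature.NumberTheory.Automorphic.SmoothCharacter     -- ★ `levelTrace`, `levelOp`, `smoothTrace_eq_integral_mul_levelTrace`, `IsLevel`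
import Mathlib.MeasureTheory.Integral.Bochner.Basic
import HarnessLib

/-!
# K2_E3 road (h413), leaf (nsc-S-C′), brick (vD-σ-MU) — «integrating out `U`»: for a representation `τ` of `P ⊇ M, U` trivial on `U`,
# `tr τ(F dμ_P) = tr (τ|_M)(F̄ dν_M)`, `F̄(m) = ∫_U F(mu) dμ_U`, whenever `∫_P = ∫_M ∫_U` and the level of `F` is of product form

Cell `pub/hodgecm-mathlib` (D-0151), Track B, seat K2E3-p24 (g0) = hand of the hosted leaf (nsc-S-C′) (road owner K2E3-p11 (g6)).
`--supports stmt-HodgeConjecture-24833 --as helper`; THEOREMS ONLY (no definition ∕ instance ∕ notation ∕ named fact ∕ `sorry`); never imports `Cruxes/…/Lines`.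
COUNT-NEUTRAL (generic representation theory on a topological group `G` with subgroups `M, U ≤ P`).

THE MATHEMATICS ([vanDijk1972, proof of Thm. p. 237: «`tr π(f) = tr σ(f̄^P)`, `f̄^P(m) = δ^{1∕2}(m)∫_K∫_U f(k⁻¹muk)`»]; [BernsteinZelevinsky1977, §1.8, §2.3];
[Cartier1979, §III.3]).  Let `τ` be an admissible representation of `P` on `W` with `τ(u) = 1` for `u ∈ U` (for `GL_N`: `τ = (σ ∘ proj) ⊗ δ_{P_c}^{1∕2}` on
`P_c = M_c U_c`), `σ' := τ|_M` (`τ.comp (inclusion M ≤ P)`), Haar data with `∫_P g dμ_P = ∫_M ∫_U g(mu) dμ_U dν_M` (`hPint`, ★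
`GLn.exists_haar_parabolic_integral_eq_levi_unipotent`), `F` a test function on `P` with a level `L ≤ P` of PRODUCT FORM — every `l ∈ L` is `m·u` with
`m ∈ M`, `m ∈ L`, `u ∈ U` (for `GL_N`: `L = P_c ∩ K_r`, `K_r` a principal congruence subgroup) — such that `μ_U` is invariant under conjugation by the
elements of `L_M := L ∩ M`.  Then:
* §1 `levelTrace_mul_of_apply_eq_one` — `Θ^τ_L(p u) = Θ^τ_L(p)` when `τ u = 1`;
* §2 **`levelTrace_inclusion_eq_levelTrace`** — `Θ^τ_L(m) = Θ^{σ'}_{L_M}(m)` for `m ∈ M`: `W^{τ(L)} = W^{σ'(L_M)}` and the `L`-orbit of any `w` under `τ`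
  is its `L_M`-orbit under `σ'` (product form + `τ(U) = 1`), so the orbit-average projectors `e_L`, `e_{L_M}` (★ `SmoothProjector.avg`) and the level
  operators coincide, and so do their traces (`LinearEquiv.ofEq` conjugation);
* §3 `isLevel_fibreIntegral` — `F̄(m) = ∫_U F(mu) dμ_U` has the level `L_M` (right invariance from the conjugation invariance of `μ_U`), and
  `hasCompactSupport_fibreIntegral` (given `M × U ≃ₜ P`);
* §4 **`smoothTrace_eq_smoothTrace_fibreIntegral`** — `tr τ(F dμ_P) = tr σ'(F̄ dν_M)` (★ `smoothTrace_eq_integral_mul_levelTrace` on both sides, `hPint`, §1–§3).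

HONEST LABEL: HC_CM is proved only modulo the 7 printed citations (2 remaining named inputs: hLiu418 = stmt-HodgeConjecture-24832, h413 =
stmt-HodgeConjecture-24833) until rung 0 closes; count-neutral helper; the `GL_N` instantiation (product form of `P_c ∩ K_r`, `Ad`-invariance of `μ_U` under
`M_c ∩ K`) is a separate brick.

## References
* [vanDijk1972] G. van Dijk, *Computation of certain induced characters of 𝔭-adic groups*, Math. Ann. 199 (1972), 229–240, Thm. p. 237.
* [BernsteinZelevinsky1977] I. N. Bernstein, A. V. Zelevinsky, *Induced representations of reductive 𝔭-adic groups I*, Ann. Sci. ÉNS 10 (1977), §1.8, §2.3.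
* [Cartier1979] P. Cartier, *Representations of 𝔭-adic groups: a survey*, PSPM 33.1 (1979), §III.3.
-/

set_option autoImplicit false
set_option linter.dupNamespace false

noncomputable section

open MeasureTheory Literature.NumberTheory.Automorphic Literature.NumberTheory.Automorphic.SmoothProjector
open scoped BigOperators

namespace Summit.HodgeConjecture.HodgeConjecture.Cruxes.H413.K2E3InflatedCharacterLeviUnipotent

open Representation

variable {G : Type*} [Group G] [TopologicalSpace G] [IsTopologicalGroup G]
  {W : Type*} [AddCommGroup W] [Module ℂ W]
  {P M U : Subgroup G} (hMP : M ≤ P) (hUP : U ≤ P) (τ : Representation ℂ ↥P W)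

/-! ## §1  `Θ^τ_L(p u) = Θ^τ_L(p)` for `τ u = 1` -/

/-- The level operator is unchanged by right multiplication with an element acting trivially. [cite: BernsteinZelevinsky1977, §1.8] -/
theorem levelOp_mul_of_apply_eq_one {L : Subgroup ↥P} (hLo : IsOpen (L : Set ↥P)) (hLc : IsCompact (L : Set ↥P)) (p u : ↥P) (hu : τ u = 1) :
    τ.levelOp hLo hLc (p * u) = τ.levelOp hLo hLc p := by
  ext v
  simp only [coe_levelOp_apply, map_mul, hu, mul_one]

/-- **`Θ^τ_L(p u) = Θ^τ_L(p)` when `τ u = 1`** (e.g. `u` in the unipotent radical of an inflated representation). [cite: BernsteinZelevinsky1977, §1.8] -/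
theorem levelTrace_mul_of_apply_eq_one {L : Subgroup ↥P} (hLo : IsOpen (L : Set ↥P)) (hLc : IsCompact (L : Set ↥P)) (p u : ↥P) (hu : τ u = 1) :
    τ.levelTrace hLo hLc (p * u) = τ.levelTrace hLo hLc p := by
  rw [levelTrace, levelTrace, levelOp_mul_of_apply_eq_one τ hLo hLc p u hu]

/-! ## §2  `Θ^τ_L(m) = Θ^{σ'}_{L ∩ M}(m)` for `σ' = τ|_M` and a level of product form -/

omit [TopologicalSpace G] [IsTopologicalGroup G] in
/-- `avg` across two representations (possibly of different groups) with the same orbit set: ★ `avg` is a function of the orbit set alone. [folklore] -/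
theorem avg_congr_of_orbitSet_eq' {G₁ G₂ : Type*} [Group G₁] [Group G₂] {ρ₁ : Representation ℂ G₁ W} {ρ₂ : Representation ℂ G₂ W}
    {H₁ : Subgroup G₁} {H₂ : Subgroup G₂} {v₁ v₂ : W} (h : orbitSet ρ₁ H₁ v₁ = orbitSet ρ₂ H₂ v₂) : avg ρ₁ H₁ v₁ = avg ρ₂ H₂ v₂ := by
  simp only [avg, h]

section Product

variable {L : Subgroup ↥P} (σ' : Representation ℂ ↥M W) (hσ' : ∀ m : ↥M, σ' m = τ (Subgroup.inclusion hMP m))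
  (hLprod : ∀ l ∈ L, ∃ m : ↥M, ∃ u : ↥U, Subgroup.inclusion hMP m ∈ L ∧ (l : G) = (m : G) * (u : G))
  (hτU : ∀ u : ↥U, τ (Subgroup.inclusion hUP u) = 1)

omit [TopologicalSpace G] [IsTopologicalGroup G] in
include hσ' hLprod hτU in
/-- For a level of product form, `τ(l) w = σ'(m) w` with `m` the `M`-part of `l ∈ L` (`σ' = τ|_M`, `τ(U) = 1`). [cite: BernsteinZelevinsky1977, §1.8] -/
theorem exists_apply_eq_of_mem {l : ↥P} (hl : l ∈ L) (w : W) :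
    ∃ m : ↥M, Subgroup.inclusion hMP m ∈ L ∧ τ l w = σ' m w := by
  obtain ⟨m, u, hm, hlu⟩ := hLprod l hl
  refine ⟨m, hm, ?_⟩
  have hl' : l = Subgroup.inclusion hMP m * Subgroup.inclusion hUP u := Subtype.ext (by simpa only [Subgroup.coe_mul, Subgroup.coe_inclusion] using hlu)
  rw [hl', map_mul, Module.End.mul_apply, hτU u, Module.End.one_apply, hσ']

omit [TopologicalSpace G] [IsTopologicalGroup G] in
include hσ' hLprod hτU in
/-- **`W^{τ(L)} = W^{σ'(L ∩ M)}`** for `σ' = τ|_M` and a level `L` of product form. [cite: BernsteinZelevinsky1977, §1.8] [cite: Cartier1979, §III.3] -/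
theorem fixedPoints_eq_fixedPoints_comap :
    τ.fixedPoints L = σ'.fixedPoints (L.comap (Subgroup.inclusion hMP)) := by
  ext w
  simp only [mem_fixedPoints, Subgroup.mem_comap]
  constructor
  · intro hw m hm
    rw [hσ']
    exact hw _ hm
  · intro hw l hl
    obtain ⟨m, hm, h⟩ := exists_apply_eq_of_mem hMP hUP τ σ' hσ' hLprod hτU hl w
    rw [h]
    exact hw m hm

omit [TopologicalSpace G] [IsTopologicalGroup G] in
include hσ' hLprod hτU in
/-- The `L`-orbit of `w` under `τ` is its `(L ∩ M)`-orbit under `σ' = τ|_M` (product form, `τ(U) = 1`). [cite: Cartier1979, §III.3] -/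
theorem orbitSet_eq_orbitSet_comap (w : W) :
    orbitSet τ L w = orbitSet σ' (L.comap (Subgroup.inclusion hMP)) w := by
  ext y
  simp only [mem_orbitSet_iff, Subgroup.mem_comap]
  constructor
  · rintro ⟨l, hl, rfl⟩
    obtain ⟨m, hm, h⟩ := exists_apply_eq_of_mem hMP hUP τ σ' hσ' hLprod hτU hl w
    exact ⟨m, hm, h.symm⟩
  · rintro ⟨m, hm, rfl⟩
    exact ⟨_, hm, by rw [hσ']⟩

include hσ' hLprod hτU in
/-- **`Θ^τ_L(m) = Θ^{σ'}_{L ∩ M}(m)` for `m ∈ M`**, `σ' = τ|_M`, and a level `L` of product form: the fixed spaces coincide (`fixedPoints_eq_fixedPoints_comap`), the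
orbit-average projectors `e_L = e_{L ∩ M}` coincide on every vector (`orbitSet_eq_orbitSet_comap`; ★ `avg` depends only on the orbit), hence the level operators
are conjugate under `LinearEquiv.ofEq` and have the same trace. [cite: vanDijk1972, Thm. p. 237] [cite: Cartier1979, §III.3] -/
theorem levelTrace_inclusion_eq_levelTrace (hLo : IsOpen (L : Set ↥P)) (hLc : IsCompact (L : Set ↥P))
    (hLMo : IsOpen ((L.comap (Subgroup.inclusion hMP) : Subgroup ↥M) : Set ↥M)) (hLMc : IsCompact ((L.comap (Subgroup.inclusion hMP) : Subgroup ↥M) : Set ↥M))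
    (m : ↥M) :
    τ.levelTrace hLo hLc (Subgroup.inclusion hMP m) = σ'.levelTrace hLMo hLMc m := by
  have heq := fixedPoints_eq_fixedPoints_comap hMP hUP τ σ' hσ' hLprod hτU (L := L)
  set e : ↥(τ.fixedPoints L) ≃ₗ[ℂ] ↥(σ'.fixedPoints (L.comap (Subgroup.inclusion hMP))) := LinearEquiv.ofEq _ _ heq with he
  rw [levelTrace, levelTrace, ← LinearMap.trace_conj' (τ.levelOp hLo hLc (Subgroup.inclusion hMP m)) e]
  congr 1
  refine LinearMap.ext fun v => Subtype.ext ?_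
  rw [LinearEquiv.conj_apply, LinearMap.comp_apply, LinearMap.comp_apply, LinearEquiv.coe_coe, LinearEquiv.coe_coe, he, LinearEquiv.coe_ofEq_apply,
    coe_levelOp_apply, coe_levelOp_apply, LinearEquiv.ofEq_symm, LinearEquiv.coe_ofEq_apply, hσ']
  exact avg_congr_of_orbitSet_eq' (orbitSet_eq_orbitSet_comap hMP hUP τ σ' hσ' hLprod hτU _)

end Product

/-! ## §3  The fibre integral `F̄(m) = ∫_U F(mu) dμ_U` is a test function on `M` -/

section Fibre

variable [MeasurableSpace ↥U] [BorelSpace ↥U] (μU : Measure ↥U) {L : Subgroup ↥P}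
  (hMU : ∀ (m : ↥M) (u : ↥U), (m : G) * (u : G) * (m : G)⁻¹ ∈ U)

omit [TopologicalSpace G] [IsTopologicalGroup G] [MeasurableSpace ↥U] [BorelSpace ↥U] in
/-- `(m₀ m) u = m₀ · (m u)` in `P`. [folklore] -/
theorem mk_mul_mul_eq (m₀ m : ↥M) (u : ↥U) :
    (⟨((m₀ * m : ↥M) : G) * (u : G), P.mul_mem (hMP (m₀ * m).2) (hUP u.2)⟩ : ↥P) =
      Subgroup.inclusion hMP m₀ * ⟨(m : G) * (u : G), P.mul_mem (hMP m.2) (hUP u.2)⟩ :=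
  Subtype.ext (by simp only [Subgroup.coe_mul, Subgroup.coe_inclusion, mul_assoc])

omit [TopologicalSpace G] [IsTopologicalGroup G] [MeasurableSpace ↥U] [BorelSpace ↥U] in
include hMU in
/-- `(m m₀) u = m · (m₀ u m₀⁻¹) · m₀` in `P`. [folklore] -/
theorem mk_mul_mul_eq' (m m₀ : ↥M) (u : ↥U) :
    (⟨((m * m₀ : ↥M) : G) * (u : G), P.mul_mem (hMP (m * m₀).2) (hUP u.2)⟩ : ↥P) =
      ⟨(m : G) * (((⟨(m₀ : G) * (u : G) * (m₀ : G)⁻¹, hMU m₀ u⟩ : ↥U)) : G), P.mul_mem (hMP m.2) (hUP (hMU m₀ u))⟩ * Subgroup.inclusion hMP m₀ :=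
  Subtype.ext (by simp only [Subgroup.coe_mul, Subgroup.coe_inclusion]; group)

omit [BorelSpace ↥U] in
include hMU in
/-- **`F̄(m) = ∫_U F(mu) dμ_U` has the level `L ∩ M`** when `F` has the level `L` and `μ_U` is invariant under conjugation by the elements of `L ∩ M` (the left
invariance is formal; the right invariance is `F(m m₀ u) = F(m · m₀um₀⁻¹ · m₀) = F(m · m₀um₀⁻¹)` and the substitution `u ↦ m₀⁻¹ u m₀`).
[cite: vanDijk1972, Thm. p. 237] [cite: BernsteinZelevinsky1977, §1.8] -/
theorem isLevel_fibreIntegral {F : ↥P → ℂ} (hL : IsLevel L F) (hFc : Continuous F)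
    (hLMo : IsOpen ((L.comap (Subgroup.inclusion hMP) : Subgroup ↥M) : Set ↥M)) (hLMc : IsCompact ((L.comap (Subgroup.inclusion hMP) : Subgroup ↥M) : Set ↥M))
    (hμU : ∀ m₀ : ↥M, Subgroup.inclusion hMP m₀ ∈ L → ∀ g : ↥U → ℂ, Continuous g →
      ∫ u, g ⟨(m₀ : G) * (u : G) * (m₀ : G)⁻¹, hMU m₀ u⟩ ∂μU = ∫ u, g u ∂μU) :
    IsLevel (L.comap (Subgroup.inclusion hMP)) (fun m : ↥M => ∫ u : ↥U, F ⟨(m : G) * (u : G), P.mul_mem (hMP m.2) (hUP u.2)⟩ ∂μU) := by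
  refine ⟨hLMo, hLMc, fun m₀ hm₀ m => ?_, fun m₀ hm₀ m => ?_⟩
  · -- right invariance
    have h1 : ∀ u : ↥U, F ⟨((m * m₀ : ↥M) : G) * (u : G), P.mul_mem (hMP (m * m₀).2) (hUP u.2)⟩ =
        F ⟨(m : G) * (((⟨(m₀ : G) * (u : G) * (m₀ : G)⁻¹, hMU m₀ u⟩ : ↥U)) : G), P.mul_mem (hMP m.2) (hUP (hMU m₀ u))⟩ := fun u => by
      rw [mk_mul_mul_eq' hMP hUP hMU, hL.mul_right _ (Subgroup.mem_comap.1 hm₀)]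
    simp_rw [h1]
    exact hμU m₀ (Subgroup.mem_comap.1 hm₀) (fun u : ↥U => F ⟨(m : G) * (u : G), P.mul_mem (hMP m.2) (hUP u.2)⟩)
      (hFc.comp (by fun_prop))
  · -- left invariance
    refine integral_congr_ae (Filter.Eventually.of_forall fun u => ?_)
    simp only
    rw [mk_mul_mul_eq hMP hUP, hL.mul_left _ (Subgroup.mem_comap.1 hm₀)]

omit [MeasurableSpace ↥U] [BorelSpace ↥U] in
/-- **`F̄` has compact support** (given the topological decomposition `M × U ≃ₜ P`): `supp F̄ ⊆ pr_M(e⁻¹(tsupport F))`. [cite: BernsteinZelevinsky1977, §1.8] -/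
theorem hasCompactSupport_fibreIntegral [T2Space G] [MeasurableSpace ↥U] (μU : Measure ↥U) (e : ↥M × ↥U ≃ₜ ↥P)
    (he : ∀ (m : ↥M) (u : ↥U), ((e (m, u) : ↥P) : G) = (m : G) * (u : G)) {F : ↥P → ℂ} (hFc : HasCompactSupport F) :
    HasCompactSupport (fun m : ↥M => ∫ u : ↥U, F ⟨(m : G) * (u : G), P.mul_mem (hMP m.2) (hUP u.2)⟩ ∂μU) := by
  refine HasCompactSupport.intro ((hFc.image e.symm.continuous).image continuous_fst) fun m hm => ?_
  refine integral_eq_zero_of_ae (Filter.Eventually.of_forall fun u => ?_)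
  by_contra hne
  apply hm
  have hmem : (⟨(m : G) * (u : G), P.mul_mem (hMP m.2) (hUP u.2)⟩ : ↥P) ∈ tsupport F := subset_tsupport _ hne
  refine ⟨(m, u), ⟨_, hmem, ?_⟩, rfl⟩
  rw [Homeomorph.symm_apply_eq]
  exact Subtype.ext (he m u).symm

end Fibre

/-! ## §4  `tr τ(F dμ_P) = tr σ'(F̄ dν_M)` -/

section Main

variable [MeasurableSpace ↥P] [BorelSpace ↥P] (μP : Measure ↥P) [μP.IsMulLeftInvariant] [IsFiniteMeasureOnCompacts μP]
  [MeasurableSpace ↥M] [BorelSpace ↥M] (νM : Measure ↥M) [νM.IsMulLeftInvariant] [IsFiniteMeasureOnCompacts νM]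
  [MeasurableSpace ↥U] (μU : Measure ↥U)

/-- **INTEGRATING OUT `U`: `tr τ(F dμ_P) = tr σ'(F̄ dν_M)`** [vanDijk1972, proof of Thm. p. 237: «`tr π(f) = σ(f̄^P)`»].  `τ` an admissible representation of `P`
trivial on `U ≤ P`, `σ' = τ|_M` admissible, `U` normalised by `M`, `M × U ≃ₜ P` via multiplication, `∫_P g dμ_P = ∫_M ∫_U g(mu) dμ_U dν_M` (`hPint`), `F` a
test function on `P` with a level `L` of PRODUCT FORM whose `M`-part `L ∩ M` is compact open in `M` and acts on `μ_U` by measure-preserving conjugations.  Then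
`tr τ(F) = tr σ'(F̄)`, `F̄(m) = ∫_U F(mu) dμ_U`.  Proof: `tr τ(F) = ∫_P F Θ^τ_L` (★), `= ∫_M ∫_U F(mu) Θ^τ_L(mu)` (`hPint`), `Θ^τ_L(mu) = Θ^τ_L(m) = Θ^{σ'}_{L∩M}(m)`
(§1, §2), `= ∫_M F̄ Θ^{σ'}_{L∩M} = tr σ'(F̄)` (★, §3). [cite: vanDijk1972, Thm. p. 237] [cite: BernsteinZelevinsky1977, §1.8, §2.3] [cite: Cartier1979, §III.3] -/
theorem smoothTrace_eq_smoothTrace_fibreIntegral [T2Space G]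
    (hPint : ∀ g : ↥P → ℂ, Continuous g → HasCompactSupport g →
      ∫ p, g p ∂μP = ∫ m : ↥M, ∫ u : ↥U, g ⟨(m : G) * (u : G), P.mul_mem (hMP m.2) (hUP u.2)⟩ ∂μU ∂νM)
    (hτ : τ.IsAdmissible) (σ' : Representation ℂ ↥M W) (hσ'adm : σ'.IsAdmissible) (hσ' : ∀ m : ↥M, σ' m = τ (Subgroup.inclusion hMP m))
    (hτU : ∀ u : ↥U, τ (Subgroup.inclusion hUP u) = 1) (hMU : ∀ (m : ↥M) (u : ↥U), (m : G) * (u : G) * (m : G)⁻¹ ∈ U)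
    (e : ↥M × ↥U ≃ₜ ↥P) (he : ∀ (m : ↥M) (u : ↥U), ((e (m, u) : ↥P) : G) = (m : G) * (u : G))
    {F : ↥P → ℂ} (hFlc : IsLocallyConstant F) (hFc : HasCompactSupport F) {L : Subgroup ↥P} (hL : IsLevel L F)
    (hLprod : ∀ l ∈ L, ∃ m : ↥M, ∃ u : ↥U, Subgroup.inclusion hMP m ∈ L ∧ (l : G) = (m : G) * (u : G))
    (hLMo : IsOpen ((L.comap (Subgroup.inclusion hMP) : Subgroup ↥M) : Set ↥M)) (hLMc : IsCompact ((L.comap (Subgroup.inclusion hMP) : Subgroup ↥M) : Set ↥M))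
    (hμU : ∀ m₀ : ↥M, Subgroup.inclusion hMP m₀ ∈ L → ∀ g : ↥U → ℂ, Continuous g →
      ∫ u, g ⟨(m₀ : G) * (u : G) * (m₀ : G)⁻¹, hMU m₀ u⟩ ∂μU = ∫ u, g u ∂μU) :
    τ.smoothTrace μP F = σ'.smoothTrace νM (fun m : ↥M => ∫ u : ↥U, F ⟨(m : G) * (u : G), P.mul_mem (hMP m.2) (hUP u.2)⟩ ∂μU) := by
  have hFcont : Continuous F := hFlc.continuous
  -- `tr τ(F) = ∫_P F Θ^τ_L = ∫_M ∫_U F(mu) Θ^τ_L(mu)`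
  rw [τ.smoothTrace_eq_integral_mul_levelTrace μP hτ hFc hL]
  have hΘc : Continuous (τ.levelTrace hL.isOpen hL.isCompact) := (τ.isLevel_levelTrace hL.isOpen hL.isCompact).isLocallyConstant.continuous
  rw [hPint (fun p => F p * τ.levelTrace hL.isOpen hL.isCompact p) (hFcont.mul hΘc) hFc.mul_right]
  -- the right-hand side at the level `L ∩ M` of `F̄`
  have hFbarL := isLevel_fibreIntegral hMP hUP μU hMU hL hFcont hLMo hLMc hμU
  have hFbarc := hasCompactSupport_fibreIntegral hMP hUP μU e he hFc
  rw [σ'.smoothTrace_eq_integral_mul_levelTrace νM hσ'adm hFbarc hFbarL]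
  refine integral_congr_ae (Filter.Eventually.of_forall fun m => ?_)
  simp only
  -- `Θ^τ_L(mu) = Θ^τ_L(m) = Θ^{σ'}_{L ∩ M}(m)`
  have hΘ : ∀ u : ↥U, τ.levelTrace hL.isOpen hL.isCompact ⟨(m : G) * (u : G), P.mul_mem (hMP m.2) (hUP u.2)⟩ =
      σ'.levelTrace hLMo hLMc m := by
    intro u
    have hmk : (⟨(m : G) * (u : G), P.mul_mem (hMP m.2) (hUP u.2)⟩ : ↥P) = Subgroup.inclusion hMP m * Subgroup.inclusion hUP u := Subtype.ext rfl
    rw [hmk, levelTrace_mul_of_apply_eq_one τ hL.isOpen hL.isCompact _ _ (hτU u),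
      levelTrace_inclusion_eq_levelTrace hMP hUP τ σ' hσ' hLprod hτU hL.isOpen hL.isCompact hLMo hLMc m]
  simp_rw [hΘ]
  rw [integral_mul_const]

end Main

end Summit.HodgeConjecture.HodgeConjecture.Cruxes.H413.K2E3InflatedCharacterLeviUnipotent

end
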